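import Summits.ABC.IUTFork.Joshi.ATS4MainBounds
import Summits.ABC.IUTFork.Joshi.ATS4RamificationTateDivisor
import Summits.ABC.IUTFork.Joshi.ATS4Differents
import Literature.IUT.LogVolume.DifferentConductorTowerBounds
import Literature.IUT.LogVolume.Theorem110Data
import Literature.IUT.LogVolume.DistinguishedPrimesBound
import HarnessLib

/-!
# Joshi, *Arithmetic Teichmüller Spaces IV* (arXiv:2403.10430v2) Lem. 6.4.1 and Lem. 6.4.2 (1)–(2) at GENUINE number-field
# data — PROVED from the printed inputs (Galois towers, degree divisibility, Lem. 4.1.4-type ramification), without Thm. 4.6.1 (5)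

Proof-only supplier file of slot T-27 (abc-iut cell, branch E, rung LADDER-ABC:A2.E; seat abc-iut-E-t27) for the reading predicates
`MainBoundDatum.Lem641`, `.Lem642a`, `.Lem642b` of `Joshi/ATS4MainBounds.lean` (slot T-30: «E-t27 (Thm 4.6.1) supplies
`WildBoundL/WildBoundLp`»). **No side is taken** on [IUTchIII] Cor. 3.12, on Joshi's claims, or on Mochizuki's reports on them;
unrefereed preprint; the mathematics here is classical (Dedekind–Hensel bookkeeping in towers). Locators «p.N l.M» refer to the
render `HOME/lit/renders/Joshi-arxiv-2403.10430/` (v2).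

WHAT IS PROVED. Let the six log-fields of a `MainBoundDatum D` be the typed degrees of actual number fields `L_tpd ⊆ L ⊆ L′` with
Tate-divisor data in base-change relation (T-26's `logDifferent`, `TateDivisorDatum.logf`, `IsBaseChangeOf`). Then:

* `lem641_of_fields` — **Lem. 6.4.1** (p.59 l.25–27 «log(d^L) + log(f^L) ≤ log(d^{L_tpd}) + log(f^{L_tpd}) + 33») HOLDS if `L/L_tpd` is
  Galois with `[L : L_tpd] ∣ 2¹⁰·3²·5` (Lem. 6.3.2–6.3.3 / p.59 l.31) and — T-26's predicates BY NAME — `UnramifiedOutside L_tpd L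
  ({v : p_v ∣ 2·3·5} ∪ Supp 𝔮_{L_tpd})`, `TamelyRamifiedOutside L_tpd L {v : p_v ∣ 2·3·5}`. Route: the tree's kernel form of
  [IUTchIV] Thm. 1.10 Step (ii) (`Literature.IUT.LogVolume.ndeg_different_add_reduced_le_F`, constant `log(2¹¹·3³·5²) ≤ 21`,
  `log_two_pow_eleven_mul_le`), NOT the printed route through Thm. 4.6.1 (5): by `ATS4LogDiffConductorWildGeneral.lean` (5) with the
  printed constant presupposes «unramified outside V^{odd,ss}» (flag F-b), which fails for `L = L_tpd(√−1, C[15])` at the primes over `2`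
  (even residue characteristic, never in `V^{odd,ss}`); the conclusion `33` survives because `log(2¹¹·3³·5²) ≈ 14.06 ≤ 33`.
* `lem642a_of_fields`, `lem642b_of_fields` — **Lem. 6.4.2 (1), (2)** (p.60 l.1–21) HOLD given `D.Lem641` and `L′/L` Galois with
  `[L′ : L] ∣ ℓ(ℓ+1)(ℓ−1)²` (`Gal ↪ GL₂(𝔽_ℓ)`, Lem. 6.3.2), `UnramifiedOutside L L′ ({v : p_v = ℓ} ∪ V^{odd,ss}_L)`,
  `TamelyRamifiedOutside L L′ {v : p_v = ℓ}` (tree `ndeg_different_add_reduced_le_K`: `2·log ℓ ≤ 4·log ℓ`).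

FAITHFULNESS FLAGS (located on the render; not adjudications). F-e: Lem. 4.1.4 (1) (p.38 l.32–35) prints the LARGER unramified-
exceptional set `{v : v ∣ 2·3·5·ℓ} ∪ Supp(𝔮_{L_tpd})`; with primes over `ℓ` admitted (tamely ramified, outside `V^{odd,ss}_L`) the honest
bound gains `+ log ℓ` and `33` is not uniform in `ℓ` — the hypothesis here drops `ℓ` (true for `L = L_tpd(√−1, C[15])` by Néron–Ogg–
Shafarevich away from `15·(bad)`, not proved here). F-f: Lem. 4.1.4 (2) (p.38 l.36–39) prints `{v : v ∣ 2·ℓ}`; with primes over `2`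
admitted the honest constant gains `(v₂([L′:L]) + 1)·log 2`; the hypothesis here is Mochizuki's «tamely ramified outside l» ([IUTchIV]
p.24). The typed `WildBoundL`/`WildBoundLp` (Joshi's (5)-shaped inputs `3·log[L:L_tpd]`, `1·log[L′:L]`) are NOT derived and not
needed: the lemmas' CONCLUSIONS are supplied directly. Theorems only; standard axioms; no `sorry`, instance, notation or new `Prop`
fact. [claim: Joshi2024ATS4, status: disputed] (provenance of the typed items; nothing endorsed).
-/

noncomputable section

namespace Summit.ABC.IUTFork.Joshi.ATS4

open NumberField IsDedekindDomain Module Literature.IUT.LogVolume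

/-! ### Glue: T-26's ramification predicates in the shape the tree's Step (ii) engine reads -/

section Glue

variable {F K : Type*} [Field F] [NumberField F] [Field K] [NumberField K] [Algebra F K]

omit [NumberField F] in
/-- T-26's `relRamIdx F K w` (Mathlib `ramificationIdx'` over `w ∩ 𝓞_F`) is Mathlib's `Ideal.ramificationIdx` over `𝓞_F` (private copy
of `relRamIdx_eq_ramificationIdx` of `ATS4RamificationLegendre.lean`, to keep the imports light). [folklore] -/
private theorem relRamIdx_eq_ramificationIdx' (w : HeightOneSpectrum (𝓞 K)) :
    relRamIdx F K w = w.asIdeal.ramificationIdx (𝓞 F) :=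
  Ideal.ramificationIdx'_eq_ramificationIdx (finBelow F K w).asIdeal w.asIdeal (finBelow F K w).ne_bot

/-- A prime `p ∉ {2, 3, 5}` does not divide `2·3·5`. [folklore] -/
theorem not_dvd_thirty_of_not_mem {p : ℕ} (hp : p.Prime) (h : p ∉ ({2, 3, 5} : Finset ℕ)) : ¬ p ∣ 2 * 3 * 5 := by
  intro hd
  apply h
  simp only [Finset.mem_insert, Finset.mem_singleton]
  rcases (Nat.Prime.dvd_mul hp).mp hd with h6 | h5
  · rcases (Nat.Prime.dvd_mul hp).mp h6 with h2 | h3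
    · exact Or.inl ((Nat.prime_dvd_prime_iff_eq hp Nat.prime_two).mp h2)
    · exact Or.inr (Or.inl ((Nat.prime_dvd_prime_iff_eq hp Nat.prime_three).mp h3))
  · exact Or.inr (Or.inr ((Nat.prime_dvd_prime_iff_eq hp (by norm_num)).mp h5))

omit [NumberField F] in
/-- From `UnramifiedOutside F K ({v : p_v ∣ 2·3·5} ∪ S)`: `K/F` is unramified at every place of residue characteristic `∉ {2,3,5}`
not over `S` — the engine's `hunr`. [folklore] -/
theorem ramificationIdx_eq_one_of_unramifiedOutside_thirty (S : Finset (HeightOneSpectrum (𝓞 F)))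
    (hunr : UnramifiedOutside F K ({v | residueChar F v ∣ 2 * 3 * 5} ∪ ↑S))
    (w : HeightOneSpectrum (𝓞 K)) (hp : residueChar K w ∉ ({2, 3, 5} : Finset ℕ)) (hS : finBelow F K w ∉ S) :
    w.asIdeal.ramificationIdx (𝓞 F) = 1 := by
  rw [← relRamIdx_eq_ramificationIdx']
  refine hunr w fun hmem => ?_
  rcases hmem with h | h
  · rw [Set.mem_setOf_eq, residueChar_finBelow] at h
    exact not_dvd_thirty_of_not_mem (residueChar_prime K w) hp h
  · exact hS (Finset.mem_coe.mp h)

omit [NumberField F] in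
/-- From `TamelyRamifiedOutside F K {v : p_v ∣ 2·3·5}`: tame at every place of residue characteristic `∉ {2,3,5}` — the engine's `htame`.
[folklore] -/
theorem not_dvd_of_tamelyRamifiedOutside_thirty
    (htame : TamelyRamifiedOutside F K {v | residueChar F v ∣ 2 * 3 * 5})
    (w : HeightOneSpectrum (𝓞 K)) (hp : residueChar K w ∉ ({2, 3, 5} : Finset ℕ)) :
    ¬ residueChar K w ∣ w.asIdeal.ramificationIdx (𝓞 F) := by
  rw [← relRamIdx_eq_ramificationIdx']
  refine htame w fun hmem => ?_
  rw [Set.mem_setOf_eq, residueChar_finBelow] at hmem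
  exact not_dvd_thirty_of_not_mem (residueChar_prime K w) hp hmem

omit [NumberField F] in
/-- From `UnramifiedOutside F K ({v : p_v = ℓ} ∪ S)`: unramified at every place of residue characteristic `≠ ℓ` not over `S`.
[folklore] -/
theorem ramificationIdx_eq_one_of_unramifiedOutside_ell {ℓ : ℕ} (S : Finset (HeightOneSpectrum (𝓞 F)))
    (hunr : UnramifiedOutside F K ({v | residueChar F v = ℓ} ∪ ↑S))
    (w : HeightOneSpectrum (𝓞 K)) (hp : residueChar K w ≠ ℓ) (hS : finBelow F K w ∉ S) :
    w.asIdeal.ramificationIdx (𝓞 F) = 1 := by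
  rw [← relRamIdx_eq_ramificationIdx']
  refine hunr w fun hmem => ?_
  rcases hmem with h | h
  · rw [Set.mem_setOf_eq, residueChar_finBelow] at h
    exact hp h
  · exact hS (Finset.mem_coe.mp h)

omit [NumberField F] in
/-- From `TamelyRamifiedOutside F K {v : p_v = ℓ}`: tame at every place of residue characteristic `≠ ℓ`. [folklore] -/
theorem not_dvd_of_tamelyRamifiedOutside_ell {ℓ : ℕ}
    (htame : TamelyRamifiedOutside F K {v | residueChar F v = ℓ})
    (w : HeightOneSpectrum (𝓞 K)) (hp : residueChar K w ≠ ℓ) :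
    ¬ residueChar K w ∣ w.asIdeal.ramificationIdx (𝓞 F) := by
  rw [← relRamIdx_eq_ramificationIdx']
  refine htame w fun hmem => ?_
  rw [Set.mem_setOf_eq, residueChar_finBelow] at hmem
  exact hp hmem

end Glue

/-! ### The two tower steps in T-26's vocabulary (`logDifferent`, `TateDivisorDatum.logf`) -/

section Steps

variable (F K : Type*) [Field F] [NumberField F] [Field K] [NumberField K] [Algebra F K]

/-- **First step `L/L_tpd` (the content of Lem. 6.4.1's proof, p.59 l.28–35, in [IUTchIV] Step (ii)'s form)**: for `K/F` Galois with
`[K:F] ∣ 2¹⁰·3²·5`, Tate-divisor data in base-change relation, `K/F` unramified outside `{v : p_v ∣ 30} ∪ V^{odd,ss}_F` and tamely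
ramified outside `{v : p_v ∣ 30}`: `log(d^K) + log(f^K) ≤ log(d^F) + log(f^F) + log(2¹¹·3³·5²)` (tree
`ndeg_different_add_reduced_le_F`). [cite: BombieriGubler2006, Thm B.2.11] -/
theorem logDifferent_add_logf_le_F [IsGalois F K] (𝔮F : TateDivisorDatum F) (𝔮K : TateDivisorDatum K)
    (hbc : 𝔮K.IsBaseChangeOf 𝔮F) (hdvd : finrank F K ∣ 2 ^ 10 * 3 ^ 2 * 5)
    (hunr : UnramifiedOutside F K ({v | residueChar F v ∣ 2 * 3 * 5} ∪ ↑𝔮F.V))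
    (htame : TamelyRamifiedOutside F K {v | residueChar F v ∣ 2 * 3 * 5}) :
    logDifferent K + 𝔮K.logf ≤ logDifferent F + 𝔮F.logf + Real.log (2 ^ 11 * 3 ^ 3 * 5 ^ 2) :=
  ndeg_different_add_reduced_le_F F K 𝔮F.V 𝔮K.V (fun w => hbc.1 w) hdvd
    (fun w hp hS => ramificationIdx_eq_one_of_unramifiedOutside_thirty 𝔮F.V hunr w hp hS)
    (fun w hp _ => not_dvd_of_tamelyRamifiedOutside_thirty htame w hp)

/-- **Second step `L′/L` (the content of Lem. 6.4.2's proof, p.60 l.22–30, in [IUTchIV] Step (ii)'s form)**: for `K/F` Galois with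
`[K:F] ∣ ℓ(ℓ+1)(ℓ−1)²` (`ℓ ≥ 5` prime), Tate-divisor data in base-change relation, `K/F` unramified outside `{v : p_v = ℓ} ∪ V^{odd,ss}_F`
and tamely ramified outside `{v : p_v = ℓ}`: `log(d^K) + log(f^K) ≤ log(d^F) + log(f^F) + 2·log ℓ` (tree `ndeg_different_add_reduced_le_K`).
[cite: BombieriGubler2006, Thm B.2.11] -/
theorem logDifferent_add_logf_le_K [IsGalois F K] {ℓ : ℕ} (hl : ℓ.Prime) (h5 : 5 ≤ ℓ)
    (𝔮F : TateDivisorDatum F) (𝔮K : TateDivisorDatum K)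
    (hbc : 𝔮K.IsBaseChangeOf 𝔮F) (hdvd : finrank F K ∣ ℓ * (ℓ + 1) * (ℓ - 1) ^ 2)
    (hunr : UnramifiedOutside F K ({v | residueChar F v = ℓ} ∪ ↑𝔮F.V))
    (htame : TamelyRamifiedOutside F K {v | residueChar F v = ℓ}) :
    logDifferent K + 𝔮K.logf ≤ logDifferent F + 𝔮F.logf + 2 * Real.log ℓ :=
  ndeg_different_add_reduced_le_K F K hl h5 𝔮F.V 𝔮K.V (fun w => hbc.1 w) hdvd
    (fun w hp hS => ramificationIdx_eq_one_of_unramifiedOutside_ell 𝔮F.V hunr w hp hS)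
    (fun w hp _ => not_dvd_of_tamelyRamifiedOutside_ell htame w hp)

end Steps

/-! ### Lem. 6.4.1 and Lem. 6.4.2 at genuine data -/

namespace MainBoundDatum

variable (D : MainBoundDatum)

/-- **[J-IV] Lemma 6.4.1 at genuine number-field data — PROVED** (p.59 l.25–27 «log(d^L) + log(f^L) ≤ log(d^{L_tpd}) + log(f^{L_tpd})
+ 33»): if the four fields of `D` are the degrees of actual fields `L_tpd ⊆ L` with Tate-divisor data in base-change relation, `L/L_tpd`
Galois with `[L : L_tpd] ∣ 2¹⁰·3²·5` (p.59 l.31; Lem. 6.3.2–6.3.3), unramified outside `{v : p_v ∣ 2·3·5} ∪ Supp(𝔮_{L_tpd})` and tamely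
ramified outside `{v : p_v ∣ 2·3·5}` (Lem. 4.1.4 (1) with «ℓ» removed from the first set, flag F-e), then `D.Lem641`
(`log(2¹¹·3³·5²) ≤ 21 ≤ 33`). [cite: BombieriGubler2006, Thm B.2.11] -/
theorem lem641_of_fields (Ltpd L : Type*) [Field Ltpd] [NumberField Ltpd] [Field L] [NumberField L] [Algebra Ltpd L]
    [IsGalois Ltpd L] (𝔮tpd : TateDivisorDatum Ltpd) (𝔮L : TateDivisorDatum L) (hbc : 𝔮L.IsBaseChangeOf 𝔮tpd)
    (h₁ : D.logDiffLtpd = logDifferent Ltpd) (h₂ : D.logCondLtpd = 𝔮tpd.logf) (h₃ : D.logDiffL = logDifferent L)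
    (h₄ : D.logCondL = 𝔮L.logf) (hdvd : finrank Ltpd L ∣ 2 ^ 10 * 3 ^ 2 * 5)
    (hunr : UnramifiedOutside Ltpd L ({v | residueChar Ltpd v ∣ 2 * 3 * 5} ∪ ↑𝔮tpd.V))
    (htame : TamelyRamifiedOutside Ltpd L {v | residueChar Ltpd v ∣ 2 * 3 * 5}) : D.Lem641 := by
  have key := logDifferent_add_logf_le_F Ltpd L 𝔮tpd 𝔮L hbc hdvd hunr htame
  have h21 := log_two_pow_eleven_mul_le
  unfold Lem641
  rw [h₁, h₂, h₃, h₄]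
  linarith

/-- **[J-IV] Lemma 6.4.2 (1) at genuine number-field data — PROVED** (p.60 l.1–5 «log(d^{L′}) ≤ log(d^{L′}) + log(f^{L′}) ≤
log(d^{L_tpd}) + log(f^{L_tpd}) + 4·log(ℓ) + 33»): given `D.Lem641` (e.g. `lem641_of_fields`), if the `L`, `L′` fields of `D` are the
degrees of actual fields `L ⊆ L′` with Tate-divisor data in base-change relation, `L′/L` Galois with `[L′ : L] ∣ ℓ(ℓ+1)(ℓ−1)²`
(`Gal(L′/L) ↪ GL₂(𝔽_ℓ)`, Lem. 6.3.2, p.60 l.26–27), unramified outside `{v : p_v = ℓ} ∪ V^{odd,ss}_L` and tamely ramified outside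
`{v : p_v = ℓ}` (Lem. 4.1.4 (2) with «2» removed, flag F-f), then `D.Lem642a` (`2·log ℓ ≤ 4·log ℓ`). [cite: BombieriGubler2006, Thm B.2.11] -/
theorem lem642a_of_fields (L L' : Type*) [Field L] [NumberField L] [Field L'] [NumberField L'] [Algebra L L']
    [IsGalois L L'] (𝔮L : TateDivisorDatum L) (𝔮L' : TateDivisorDatum L') (hbc : 𝔮L'.IsBaseChangeOf 𝔮L)
    (h₃ : D.logDiffL = logDifferent L) (h₄ : D.logCondL = 𝔮L.logf) (h₅ : D.logDiffLp = logDifferent L')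
    (h₆ : D.logCondLp = 𝔮L'.logf) (hdvd : finrank L L' ∣ D.ell * (D.ell + 1) * (D.ell - 1) ^ 2)
    (hunr : UnramifiedOutside L L' ({v | residueChar L v = D.ell} ∪ ↑𝔮L.V))
    (htame : TamelyRamifiedOutside L L' {v | residueChar L v = D.ell}) (h641 : D.Lem641) : D.Lem642a := by
  have key := logDifferent_add_logf_le_K L L' D.ell_prime D.five_le_ell 𝔮L 𝔮L' hbc hdvd hunr htame
  have hf := D.logCondLp_nonneg
  have hlog : 0 ≤ Real.log D.ell := Real.log_natCast_nonneg _
  unfold Lem641 at h641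
  unfold Lem642a
  rw [h₃, h₄] at h641
  rw [h₆] at hf
  rw [h₅, h₆]
  constructor
  · linarith
  · linarith

/-- **[J-IV] Lemma 6.4.2 (2) at genuine number-field data — PROVED** (p.60 l.6–21): under the hypotheses of `lem642a_of_fields`,
`D.Lem642b` (T-30's `lem642b_of_lem642a`); this is the input `Lem642₂` of Thm. 6.10.1's chain (`ATS4DescentToFirstMainBound.lem642_iff`,
`ATS4LocusUpperBounds.thm6101_of_inputs`). [cite: BombieriGubler2006, Thm B.2.11] -/
theorem lem642b_of_fields (L L' : Type*) [Field L] [NumberField L] [Field L'] [NumberField L'] [Algebra L L']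
    [IsGalois L L'] (𝔮L : TateDivisorDatum L) (𝔮L' : TateDivisorDatum L') (hbc : 𝔮L'.IsBaseChangeOf 𝔮L)
    (h₃ : D.logDiffL = logDifferent L) (h₄ : D.logCondL = 𝔮L.logf) (h₅ : D.logDiffLp = logDifferent L')
    (h₆ : D.logCondLp = 𝔮L'.logf) (hdvd : finrank L L' ∣ D.ell * (D.ell + 1) * (D.ell - 1) ^ 2)
    (hunr : UnramifiedOutside L L' ({v | residueChar L v = D.ell} ∪ ↑𝔮L.V))
    (htame : TamelyRamifiedOutside L L' {v | residueChar L v = D.ell}) (h641 : D.Lem641) : D.Lem642b :=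
  D.lem642b_of_lem642a (D.lem642a_of_fields L L' 𝔮L 𝔮L' hbc h₃ h₄ h₅ h₆ hdvd hunr htame h641)

/-- **The §6.4 chain end to end at genuine data**: for a tower `L_tpd ⊆ L ⊆ L′` of actual number fields carrying the six log-fields of
`D`, with both steps Galois of the printed degrees and the Lem. 4.1.4-type ramification (flags F-e/F-f), `D.Lem641 ∧ D.Lem642a ∧
D.Lem642b` — Joshi's constants `33`, `4·log ℓ + 33`, `4·log ℓ + 74` all hold (from Mochizuki's sharper `21`, `2·log ℓ`).
[cite: BombieriGubler2006, Thm B.2.11] -/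
theorem sec64_of_fields (Ltpd L L' : Type*) [Field Ltpd] [NumberField Ltpd] [Field L] [NumberField L] [Field L']
    [NumberField L'] [Algebra Ltpd L] [Algebra L L'] [IsGalois Ltpd L] [IsGalois L L']
    (𝔮tpd : TateDivisorDatum Ltpd) (𝔮L : TateDivisorDatum L) (𝔮L' : TateDivisorDatum L')
    (hbc : 𝔮L.IsBaseChangeOf 𝔮tpd) (hbc' : 𝔮L'.IsBaseChangeOf 𝔮L)
    (h₁ : D.logDiffLtpd = logDifferent Ltpd) (h₂ : D.logCondLtpd = 𝔮tpd.logf) (h₃ : D.logDiffL = logDifferent L)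
    (h₄ : D.logCondL = 𝔮L.logf) (h₅ : D.logDiffLp = logDifferent L') (h₆ : D.logCondLp = 𝔮L'.logf)
    (hdvd : finrank Ltpd L ∣ 2 ^ 10 * 3 ^ 2 * 5) (hdvd' : finrank L L' ∣ D.ell * (D.ell + 1) * (D.ell - 1) ^ 2)
    (hunr : UnramifiedOutside Ltpd L ({v | residueChar Ltpd v ∣ 2 * 3 * 5} ∪ ↑𝔮tpd.V))
    (htame : TamelyRamifiedOutside Ltpd L {v | residueChar Ltpd v ∣ 2 * 3 * 5})
    (hunr' : UnramifiedOutside L L' ({v | residueChar L v = D.ell} ∪ ↑𝔮L.V))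
    (htame' : TamelyRamifiedOutside L L' {v | residueChar L v = D.ell}) :
    D.Lem641 ∧ D.Lem642a ∧ D.Lem642b := by
  have h641 := D.lem641_of_fields Ltpd L 𝔮tpd 𝔮L hbc h₁ h₂ h₃ h₄ hdvd hunr htame
  exact ⟨h641, D.lem642a_of_fields L L' 𝔮L 𝔮L' hbc' h₃ h₄ h₅ h₆ hdvd' hunr' htame' h641,
    D.lem642b_of_fields L L' 𝔮L 𝔮L' hbc' h₃ h₄ h₅ h₆ hdvd' hunr' htame' h641⟩

end MainBoundDatum

end Summit.ABC.IUTFork.Joshi.ATS4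

end
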